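import Summits.RiemannHypothesis.RiemannHypothesis.Theorems.UniversalFactorMediumDefs

/-!
# RiemannHypothesis / UniversalFactor — box and cover checks of the one-sided averages (checker definitions, II)

Route `RiemannHypothesis/UniversalFactor`, crux `MediumKernelNoGo` (stmt-RiemannHypothesis-2577), line
`one-sided-average-sign-test`. DEFINITIONS only, continuing `UniversalFactorMediumDefs.lean`:

* `OsaPoint`, `osaNodeVals` — a certificate point `x` with its y-rule geometry, and the enclosures of
  `H_0(|x ∓ y_{cj}|)` at the y-nodes `y_{cj} = (2c+1)ρ_y + ρ_y t_j` (computed once per point by the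
  u-side evaluator `osaH0`);
* `osaSideSum`, `osaSideErr`, `osaTailBound`, `osaBoxCheck` — for an `a`-box `[A₁/AD, A₂/AD]`: the
  interval-weighted Gauss–Legendre sums `Σ ρ_y W_j · H_0(|x ∓ y_{cj}|) · [e^{−a₂y_{cj}}, e^{−a₁y_{cj}}]`
  (one interval computation valid for every `a` of the box), the quadrature error
  `Σ_c 5 e^{a(R_y − Y_c)} · osaDefectQ(ρ_y, R_y)` (disc bound `‖H_0‖ ≤ 5` for `|Im| ≤ 12` times the
  weight), the tails `e^{−a₁Y}/a₁` (`‖H_0‖ ≤ H_0(0) ≤ 1` on `ℝ`), and the dip / hump sign decision;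
* `osaCoverCheck` — a window `[A₀/AD, A_m/AD]` covered by consecutive boxes, each assigned a point;
* real-valued mirrors (`osaPhiN`, `osaPhiNC`, `osaThetaT`, `osaPhiMajR`, `osaDefectR`, `osaCellGL`) and the
  validity predicate `OsaCtx.Valid` used by the soundness theorems (`UniversalFactorMediumU*.lean`).
-/

set_option linter.dupNamespace false

namespace Summit.RiemannHypothesis.RiemannHypothesis.Theorems

open Literature.Analysis.ValidatedNumerics Literature.Analysis.ValidatedNumerics.NumericsMP
open Literature.NumberTheory.LFunctions

/-! ## The box check of the one-sided averages -/

/-- A certificate point: `x = xn/xd`, the y-rule geometry (`ρ_y = rhoYn/rhoYd`, Cauchy radius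
`R_y = RYn/RYd ≤ 12`), the numbers of backward / forward y-cells, and the expected shape
(`dip = true`: `H_0(x) < 0 < P, Q`; `false`: hump). [folklore] -/
structure UniversalFactor.OsaPoint where
  /-- numerator of `x` -/
  xn : ℕ
  /-- denominator of `x` -/
  xd : ℕ
  /-- numerator of `ρ_y` -/
  rhoYn : ℕ
  /-- denominator of `ρ_y` -/
  rhoYd : ℕ
  /-- numerator of `R_y` -/
  RYn : ℕ
  /-- denominator of `R_y` -/
  RYd : ℕ
  /-- number of backward y-cells -/
  CyB : ℕ
  /-- number of forward y-cells -/
  CyF : ℕ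
  /-- dip (`true`) or hump (`false`) -/
  dip : Bool
  deriving Repr

/-- The y-node `y_{cj} = (2c+1)ρ_y + ρ_y t_j` of a point, as a rational. [folklore] -/
def UniversalFactor.OsaPoint.yQ (pt : UniversalFactor.OsaPoint) (c j : ℕ) : ℚ :=
  ((2 * c + 1) * pt.rhoYn * UniversalFactor.osaGlS + pt.rhoYn * UniversalFactor.osaNodes.getD j 0 : ℤ) /
    ((pt.rhoYd * UniversalFactor.osaGlS : ℕ) : ℚ)

/-- Enclosures of `H_0(|x ∓ y_{cj}|)` at the y-nodes of one side (`bwd = true`: `x − y`), flat index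
`c*32+j`, for the indices `i, i+1, …` (`fuel` of them), appended to `arr`. [folklore] -/
def UniversalFactor.osaNodeVals (C : UniversalFactor.OsaCtx) (pt : UniversalFactor.OsaPoint) (bwd : Bool) :
    ℕ → ℕ → Array MI → Option (Array MI)
  | 0, _, arr => some arr
  | fuel + 1, i, arr =>
    let c := i / 32
    let j := i % 32
    let x' : ℚ := if bwd then (pt.xn : ℚ) / pt.xd - pt.yQ c j else (pt.xn : ℚ) / pt.xd + pt.yQ c j
    let ax : ℚ := |x'|
    match UniversalFactor.osaH0 C ax.num.toNat ax.den with
    | some v => UniversalFactor.osaNodeVals C pt bwd fuel (i + 1) (arr.push v)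
    | none => none

/-- Table of `e^{−(A/AD)·t_k}`, `t_k = f k`, for `k, k+1, …` (`fuel` of them), appended to `arr`. [folklore] -/
def UniversalFactor.osaExpTab (C : UniversalFactor.OsaCtx) (A AD : ℕ) (f : ℕ → ℚ) : ℕ → ℕ → Array MI → Option (Array MI)
  | 0, _, arr => some arr
  | fuel + 1, k, arr =>
    match MI.exp C.S C.Kexp C.kexp (MI.ofFrac C.S (-(A * f k)).num ((-(A * f k)).den * AD)) with
    | some E => UniversalFactor.osaExpTab C A AD f fuel (k + 1) (arr.push E)
    | none => none

/-- The four weight tables of one side of a box `[A₁/AD, A₂/AD]` with `Cy` cells: the cell factors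
`e^{−a_k (2c+1)ρ_y}` (`c < Cy`) and the node factors `e^{−a_k ρ_y x_j}` (`j < 32`), for `k = 2, 1`
(so that `e^{−a y_{cj}}`, `y_{cj} = (2c+1)ρ_y + ρ_y x_j`, is a product of two table entries). [folklore] -/
def UniversalFactor.osaWTabs (C : UniversalFactor.OsaCtx) (pt : UniversalFactor.OsaPoint) (A₁ A₂ AD Cy : ℕ) :
    Option (Array MI × Array MI × Array MI × Array MI) :=
  let fc : ℕ → ℚ := fun c => (2 * c + 1) * ((pt.rhoYn : ℚ) / pt.rhoYd)
  let fj : ℕ → ℚ := fun j => (pt.rhoYn : ℚ) / pt.rhoYd * UniversalFactor.osaNodeQ j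
  match UniversalFactor.osaExpTab C A₂ AD fc Cy 0 #[], UniversalFactor.osaExpTab C A₁ AD fc Cy 0 #[],
    UniversalFactor.osaExpTab C A₂ AD fj 32 0 #[], UniversalFactor.osaExpTab C A₁ AD fj 32 0 #[] with
  | some EC₂, some EC₁, some EJ₂, some EJ₁ => some (EC₂, EC₁, EJ₂, EJ₁)
  | _, _, _, _ => none

/-- The interval-weighted side sum over the flat indices `i, i+1, …` (`fuel` of them), added to `acc`:
`Σ ρ_y W_j · vals[c*32+j] · [e^{−a₂ y_{cj}}, e^{−a₁ y_{cj}}]`, the weight interval assembled from the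
tables `W` of `osaWTabs`. [folklore] -/
def UniversalFactor.osaSideSum (C : UniversalFactor.OsaCtx) (pt : UniversalFactor.OsaPoint) (vals : Array MI)
    (W : Array MI × Array MI × Array MI × Array MI) : ℕ → ℕ → MI → MI
  | 0, _, acc => acc
  | fuel + 1, i, acc =>
    let c := i / 32
    let j := i % 32
    let w : ℚ := (pt.rhoYn : ℚ) / pt.rhoYd * UniversalFactor.osaWeightQ j
    let elo : MI := MI.mul C.S (W.1.getD c (MI.ofInt C.S 0)) (W.2.2.1.getD j (MI.ofInt C.S 0))
    let ehi : MI := MI.mul C.S (W.2.1.getD c (MI.ofInt C.S 0)) (W.2.2.2.getD j (MI.ofInt C.S 0))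
    let wt : MI := ⟨elo.lo, ehi.hi⟩
    UniversalFactor.osaSideSum C pt vals W fuel (i + 1)
      (acc.add (MI.mul C.S (MI.mul C.S (vals.getD i (MI.ofInt C.S 0)) wt) (MI.ofFrac C.S w.num w.den)))

/-- Scaled upper bound of the quadrature error of one side for the box, cells `c, c+1, …` (`fuel` of
them) added to `acc`: `Σ_c 5 · max(e^{−a₁(Y_c − R_y)}, e^{−a₂(Y_c − R_y)}) · osaDefectQ(ρ_y, R_y)`,
`Y_c = (2c+1)ρ_y`. [folklore] -/
def UniversalFactor.osaSideErr (C : UniversalFactor.OsaCtx) (pt : UniversalFactor.OsaPoint) (A₁ A₂ AD : ℕ) (dS : ℤ) :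
    ℕ → ℕ → ℤ → Option ℤ
  | 0, _, acc => some acc
  | fuel + 1, c, acc =>
    let ρ : ℚ := (pt.rhoYn : ℚ) / pt.rhoYd
    let R : ℚ := (pt.RYn : ℚ) / pt.RYd
    let d : ℚ := R - (2 * c + 1) * ρ
    match MI.exp C.S C.Kexp C.kexp (MI.ofFrac C.S (A₁ * d).num ((A₁ * d).den * AD)),
      MI.exp C.S C.Kexp C.kexp (MI.ofFrac C.S (A₂ * d).num ((A₂ * d).den * AD)) with
    | some e1, some e2 =>
      UniversalFactor.osaSideErr C pt A₁ A₂ AD dS fuel (c + 1) (acc + Numerics.cdiv (5 * max e1.hi e2.hi * dS) C.S + 1)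
    | _, _ => none

/-- Scaled upper bound of the tail `e^{−a₁ Y}/a₁` beyond `Y = 2 Cy ρ_y` (from `‖H_0‖ ≤ H_0(0) = ∫₀^∞ Φ ≤ 1`
on the real axis). [folklore] -/
def UniversalFactor.osaTailBound (C : UniversalFactor.OsaCtx) (pt : UniversalFactor.OsaPoint) (A₁ AD Cy : ℕ) : Option ℤ :=
  let Y : ℚ := 2 * Cy * ((pt.rhoYn : ℚ) / pt.rhoYd)
  match MI.exp C.S C.Kexp C.kexp (MI.ofFrac C.S (-(A₁ * Y)).num ((-(A₁ * Y)).den * AD)) with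
  | some e => some (Numerics.cdiv (e.hi * AD) A₁ + 1)
  | none => none

/-- **The box check** at a point with precomputed node values `(valsB, valsF)`: the sign of `H_0(x)`
and of both one-sided averages for every `a ∈ [A₁/AD, A₂/AD]` (dip: `H_0(x) < 0`, lower ends of the
weighted sums minus errors `> 0`; hump: the mirror image). [folklore] -/
def UniversalFactor.osaBoxCheck (C : UniversalFactor.OsaCtx) (pt : UniversalFactor.OsaPoint) (hx : MI)
    (valsB valsF : Array MI) (A₁ A₂ AD : ℕ) : Bool :=
  let dS : ℤ := UniversalFactor.osaCeilQ C.S (UniversalFactor.osaDefectQ ((pt.rhoYn : ℚ) / pt.rhoYd) ((pt.RYn : ℚ) / pt.RYd))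
  match UniversalFactor.osaWTabs C pt A₁ A₂ AD pt.CyB, UniversalFactor.osaWTabs C pt A₁ A₂ AD pt.CyF,
    UniversalFactor.osaSideErr C pt A₁ A₂ AD dS pt.CyB 0 0, UniversalFactor.osaSideErr C pt A₁ A₂ AD dS pt.CyF 0 0,
    UniversalFactor.osaTailBound C pt A₁ AD pt.CyB, UniversalFactor.osaTailBound C pt A₁ AD pt.CyF with
  | some WB, some WF, some eP, some eQ, some tP, some tQ =>
    let P : MI := UniversalFactor.osaSideSum C pt valsB WB (32 * pt.CyB) 0 (MI.ofInt C.S 0)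
    let Q : MI := UniversalFactor.osaSideSum C pt valsF WF (32 * pt.CyF) 0 (MI.ofInt C.S 0)
    if pt.dip then decide (hx.hi < 0 ∧ eP + tP < P.lo ∧ eQ + tQ < Q.lo)
    else decide (0 < hx.lo ∧ P.hi + eP + tP < 0 ∧ Q.hi + eQ + tQ < 0)
  | _, _, _, _, _, _ => false

/-- Everything the boxes at one point share: `H_0(x)` and the node values of both sides. [folklore] -/
def UniversalFactor.osaPointData (C : UniversalFactor.OsaCtx) (pt : UniversalFactor.OsaPoint) :
    Option (MI × Array MI × Array MI) :=
  match UniversalFactor.osaH0 C pt.xn pt.xd, UniversalFactor.osaNodeVals C pt true (32 * pt.CyB) 0 #[],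
    UniversalFactor.osaNodeVals C pt false (32 * pt.CyF) 0 #[] with
  | some h, some vB, some vF => some (h, vB, vF)
  | _, _, _ => none

/-- Point data of every point of a list. [folklore] -/
def UniversalFactor.osaAllPointData (C : UniversalFactor.OsaCtx) :
    List UniversalFactor.OsaPoint → Option (Array (MI × Array MI × Array MI))
  | [] => some #[]
  | pt :: rest =>
    match UniversalFactor.osaPointData C pt, UniversalFactor.osaAllPointData C rest with
    | some d, some arr => some (#[d] ++ arr)
    | _, _ => none

/-- Check of the boxes `k < n`: box `k` is `[As[k], As[k+1]]/AD` at the point `pts[asg[k]]`. [folklore] -/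
def UniversalFactor.osaBoxesCheck (C : UniversalFactor.OsaCtx) (pts : List UniversalFactor.OsaPoint)
    (data : Array (MI × Array MI × Array MI)) (As asg : List ℕ) (AD : ℕ) : ℕ → Bool
  | 0 => true
  | k + 1 =>
    UniversalFactor.osaBoxesCheck C pts data As asg AD k &&
      match pts[asg.getD k 0]?, data[asg.getD k 0]? with
      | some pt, some (hx, vB, vF) =>
        decide (As.getD k 0 < As.getD (k + 1) 0) &&
          UniversalFactor.osaBoxCheck C pt hx vB vF (As.getD k 0) (As.getD (k + 1) 0) AD
      | _, _ => false

/-- Sanity of a point: positive denominators, `R_y ≤ 12`, `ρ_y < R_y`. [folklore] -/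
def UniversalFactor.OsaPoint.ok (pt : UniversalFactor.OsaPoint) : Bool :=
  decide (0 < pt.xd ∧ 0 < pt.rhoYn ∧ 0 < pt.rhoYd ∧ 0 < pt.RYd ∧ pt.RYn ≤ 12 * pt.RYd ∧
    pt.rhoYn * pt.RYd < pt.RYn * pt.rhoYd)

/-- **The cover check** of the window `[As[0]/AD, As[m]/AD]` (`m + 1 = As.length`): context sanity
(`0 < ρ_u < R_u ≤ 1/4`), all points sane, `0 < As[0]`, and every box passes. [folklore] -/
def UniversalFactor.osaCoverCheck (C : UniversalFactor.OsaCtx) (pts : List UniversalFactor.OsaPoint)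
    (As asg : List ℕ) (AD : ℕ) : Bool :=
  decide (0 < AD ∧ 0 < As.getD 0 0 ∧ 0 < C.rhoUn ∧ 0 < C.rhoUd ∧ 0 < C.RUd ∧ 4 * C.RUn ≤ C.RUd ∧
      C.rhoUn * C.RUd < C.RUn * C.rhoUd ∧ 1 ≤ C.Nth ∧ C.phiTab.size = 32 * C.Cu) &&
    pts.all UniversalFactor.OsaPoint.ok &&
    match UniversalFactor.osaAllPointData C pts with
    | some data => UniversalFactor.osaBoxesCheck C pts data As asg AD (As.length - 1)
    | none => false

/-! ## Real-valued mirrors used by the soundness statements -/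

/-- The real theta partial sum `Φ_N(u) = Σ_{n<N} Φ_n(u)`. [folklore] -/
noncomputable def UniversalFactor.osaPhiN (N : ℕ) (u : ℝ) : ℝ :=
  ∑ n ∈ Finset.range N, deBruijnPhiSummand n u

/-- The complex theta partial sum (the entire function of `stub_phiPartialC`). [folklore] -/
noncomputable def UniversalFactor.osaPhiNC (N : ℕ) (w : ℂ) : ℂ :=
  ∑ n ∈ Finset.range N, (2 * (Real.pi : ℂ) ^ 2 * ((n : ℂ) + 1) ^ 4 * Complex.exp (9 * w) -
    3 * (Real.pi : ℂ) * ((n : ℂ) + 1) ^ 2 * Complex.exp (5 * w)) *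
    Complex.exp (-((Real.pi : ℂ) * ((n : ℂ) + 1) ^ 2 * Complex.exp (4 * w)))

/-- The theta tail bound `T_N(u) = 4π²(N+1)⁴ e^{9u} exp(−π(N+1)² e^{4u})` of `stub_phiTailN`. [folklore] -/
noncomputable def UniversalFactor.osaThetaT (N : ℕ) (u : ℝ) : ℝ :=
  4 * Real.pi ^ 2 * ((N : ℝ) + 1) ^ 4 * Real.exp (9 * u) *
    Real.exp (-(Real.pi * ((N : ℝ) + 1) ^ 2 * Real.exp (4 * u)))

/-- The disc majorant of the theta partial sum around `uc` with radius `R`: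
`Σ_{n<N} (2π²(n+1)⁴e^{9(uc+R)} + 3π(n+1)²e^{5(uc+R)}) exp(−π(n+1)²e^{4(uc−R)}(1 − 8R²))`. [folklore] -/
noncomputable def UniversalFactor.osaPhiMajR (N : ℕ) (uc R : ℝ) : ℝ :=
  ∑ n ∈ Finset.range N, (2 * Real.pi ^ 2 * ((n : ℝ) + 1) ^ 4 * Real.exp (9 * (uc + R)) +
      3 * Real.pi * ((n : ℝ) + 1) ^ 2 * Real.exp (5 * (uc + R))) *
    Real.exp (-(Real.pi * ((n : ℝ) + 1) ^ 2 * Real.exp (4 * (uc - R)) * (1 - 8 * R ^ 2)))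

/-- The real defect bracket of the scaled rule (the cast of `osaDefectQ`). [folklore] -/
noncomputable def UniversalFactor.osaDefectR (ρ R : ℝ) : ℝ :=
  ∑ n ∈ Finset.range 64,
      |((ρ ^ (n + 1) - (-ρ) ^ (n + 1)) / (n + 1) -
        ∑ j ∈ Finset.range 32, (ρ * UniversalFactor.osaWeightR j) * (ρ * UniversalFactor.osaNodeR j) ^ n)| / R ^ n +
    (2 * ρ + ∑ j ∈ Finset.range 32, |ρ * UniversalFactor.osaWeightR j|) * ((ρ / R) ^ 64 / (1 - ρ / R))

/-- The Gauss–Legendre node sum of u-cell `c` for `H_0(x')`: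
`Σ_{j<32} ρW_j Φ_N(u_{cj}) cos(x' u_{cj})`, `u_{cj} = (2c+1)ρ + ρ t_j`. [folklore] -/
noncomputable def UniversalFactor.osaCellGL (N : ℕ) (ρ x' : ℝ) (c : ℕ) : ℝ :=
  ∑ j ∈ Finset.range 32, ρ * UniversalFactor.osaWeightR j *
    (UniversalFactor.osaPhiN N ((2 * c + 1) * ρ + ρ * UniversalFactor.osaNodeR j) *
      Real.cos (x' * ((2 * c + 1) * ρ + ρ * UniversalFactor.osaNodeR j)))

/-- `ρ_u` of a context as a real number. [folklore] -/
noncomputable def UniversalFactor.OsaCtx.rho (C : UniversalFactor.OsaCtx) : ℝ := (C.rhoUn : ℝ) / C.rhoUd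

/-- `R_u` of a context as a real number. [folklore] -/
noncomputable def UniversalFactor.OsaCtx.RU (C : UniversalFactor.OsaCtx) : ℝ := (C.RUn : ℝ) / C.RUd

/-- **Validity of a u-side evaluator context**: everything `mem_osaH0` needs about the tables and
error constants (established once per context by `valid_of_mkOsaCtx`). [folklore] -/
structure UniversalFactor.OsaCtx.Valid (C : UniversalFactor.OsaCtx) : Prop where
  /-- positive scale -/
  hS : 0 < C.S
  /-- `π ∈ piI` -/
  hpi : MI.mem C.S Real.pi C.piI
  /-- `ρ_u > 0` -/
  hrho : 0 < C.rhoUn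
  /-- denominator of `ρ_u` positive -/
  hrhod : 0 < C.rhoUd
  /-- `R_u > 0` -/
  hRn : 0 < C.RUn
  /-- denominator of `R_u` positive -/
  hRd : 0 < C.RUd
  /-- `R_u ≤ 1/4` -/
  hR4 : 4 * C.RUn ≤ C.RUd
  /-- `ρ_u < R_u` -/
  hρR : C.rhoUn * C.RUd < C.RUn * C.rhoUd
  /-- at least one theta term -/
  hN : 1 ≤ C.Nth
  /-- the table encloses `ρ_u W_j Φ_N(u_{cj})` -/
  htab : ∀ c j : ℕ, c < C.Cu → j < 32 →
    MI.mem C.S (C.rho * UniversalFactor.osaWeightR j *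
      UniversalFactor.osaPhiN C.Nth ((2 * c + 1) * C.rho + C.rho * UniversalFactor.osaNodeR j))
      (C.phiTab.getD (c * 32 + j) (MI.ofInt C.S 0))
  /-- `errA ≥ 0` -/
  herrA0 : 0 ≤ C.errA
  /-- `errA / S` bounds defect × Σ_c PhiMaj_c -/
  herrA : UniversalFactor.osaDefectR C.rho C.RU *
      ∑ c ∈ Finset.range C.Cu, UniversalFactor.osaPhiMajR C.Nth ((2 * c + 1) * C.rho) C.RU ≤ C.errA / C.S
  /-- `errB / S` bounds the theta tails and the `u`-tail -/
  herrB : 2 * C.rho * ∑ c ∈ Finset.range C.Cu, UniversalFactor.osaThetaT C.Nth (2 * c * C.rho) +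
      50 * Real.exp (9 * (2 * C.Cu * C.rho) - Real.pi * Real.exp (4 * (2 * C.Cu * C.rho))) /
        (4 * Real.pi * Real.exp (4 * (2 * C.Cu * C.rho)) - 9) ≤ C.errB / C.S

/-- A sane point has a positive denominator (registered sub-goal `stub_osaDefsB` of the crux item: the
anchor of this definitions file). [folklore] -/
theorem UniversalFactor.stub_osaDefsB :
    ∀ pt : UniversalFactor.OsaPoint, pt.ok = true → 0 < pt.xd := by
  intro pt h
  simp only [UniversalFactor.OsaPoint.ok, decide_eq_true_eq] at h
  exact h.1

end Summit.RiemannHypothesis.RiemannHypothesis.Theorems
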